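import Summits.QuantumAdvantage.AdviceFreeQNC0.LogDegreeResidueBalance
import HarnessLib

/-!
# Cell qa-qnc0 (rung F-Q1, route RingFrame, crux α, line `product`): `(1/3 − ε)`-equidistribution
# of low-degree supports over the residue classes mod 3

Planner statement HOME/qa-qnc0-p1/Sketch5.lean §18.1 `PLDAMSLogEqui` ("PROVED, same argument" as
`PLDAMSLog`), now a kernel theorem, literally: for every `ε > 0` there is `K` such that for
`n ≥ K·(d+1)·4^d`, every `g ∈ lowDeg 𝔽₂ n d` and every `r`,
`(1/3 − ε)·#{u : g u ≠ 0} ≤ #{u : g u ≠ 0, |u| ≡ r (mod 3)}` (`pldamsLogEqui`).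

Proof: the class-count estimate `|3·#class − #supp| ≤ 1 + 2ⁿe^{−3n/(8·4^d)}`
(`abs_three_mul_card_class_sub_card_support_le`, Viola–Wigderson at `ζ = ω`) and the
Schwartz–Zippel bound `#supp ≥ 2^{n−d}` (`Smolensky.two_pow_le_card_support`); with
`n ≥ K(d+1)4^d`, `K ≥ 3`, `(1/2)^K ≤ ε`, `2e^{−3K/8} ≤ ε`: `1 ≤ ε·2^{n−d}` and
`2ⁿe^{−3n/(8·4^d)} ≤ 2^{n−d}·(2e^{−3K/8})^{d+1} ≤ ε·2^{n−d}`.  The cell's statement; WHAT THIS IS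
NOT: anything at degree `≥ ½log₂ n`.
-/

noncomputable section

namespace Summit.QuantumAdvantage.AdviceFreeQNC0

open Finset
open Literature.Computability.MetaComplexity Literature.Computability.MetaComplexity.Smolensky
open Literature.Computability.MetaComplexity.Hegedus

/-- Choice of the constant: `K ≥ 3` with `(1/2)^K ≤ ε` and `2·(e^{−3/8})^K ≤ ε`. [folklore] -/
private theorem exists_K (ε : ℝ) (hε : 0 < ε) :
    ∃ K : ℕ, 3 ≤ K ∧ (1 / 2 : ℝ) ^ K ≤ ε ∧ 2 * Real.exp (-(3 / 8)) ^ K ≤ ε := by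
  obtain ⟨K₁, hK₁⟩ := exists_pow_lt_of_lt_one hε (by norm_num : (1 / 2 : ℝ) < 1)
  have hy1 : Real.exp (-(3 / 8)) < 1 := Real.exp_lt_one_iff.2 (by norm_num)
  have hy0 : 0 ≤ Real.exp (-(3 / 8)) := (Real.exp_pos _).le
  obtain ⟨K₂, hK₂⟩ := exists_pow_lt_of_lt_one (half_pos hε) hy1
  refine ⟨max K₁ K₂ + 3, by omega, ?_, ?_⟩
  · calc (1 / 2 : ℝ) ^ (max K₁ K₂ + 3) ≤ (1 / 2 : ℝ) ^ K₁ :=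
          pow_le_pow_of_le_one (by norm_num) (by norm_num) (by omega)
      _ ≤ ε := hK₁.le
  · calc 2 * Real.exp (-(3 / 8)) ^ (max K₁ K₂ + 3) ≤ 2 * Real.exp (-(3 / 8)) ^ K₂ :=
          mul_le_mul_of_nonneg_left (pow_le_pow_of_le_one hy0 hy1.le (by omega)) (by norm_num)
      _ ≤ ε := by linarith [hK₂.le]

/-- **`PLDAMSLogEqui` (planner Sketch5 §18.1), literally:** for every `ε > 0` there is `K` with:
`K(d+1)4^d ≤ n`, `g ∈ lowDeg 𝔽₂ n d` ⟹ `(1/3 − ε)·#{g ≠ 0} ≤ #{u : g u ≠ 0, |u| ≡ r (mod 3)}` for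
every `r`. [cite: ViolaWigderson2008, Theorem 2.9; JuknaBFC2012, Claim 2.21] -/
theorem pldamsLogEqui :
    ∀ ε : ℝ, 0 < ε → ∃ K : ℕ, ∀ n d : ℕ, K * (d + 1) * 4 ^ d ≤ n →
      ∀ g : CubeFn (ZMod 2) n, g ∈ lowDeg (ZMod 2) n d → ∀ r : ℕ,
        (1 / 3 - ε) * ((univ.filter fun u : Fin n → Bool => g u ≠ 0).card : ℝ) ≤
          ((univ.filter fun u : Fin n → Bool => g u ≠ 0 ∧ wt u % 3 = r % 3).card : ℝ) := by
  intro ε hε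
  obtain ⟨K, hK3, hKε, hKe⟩ := exists_K ε hε
  refine ⟨K, fun n d hn g hg r => ?_⟩
  set B : ℝ := ((univ.filter fun u : Fin n → Bool => g u ≠ 0).card : ℝ) with hB
  set A : ℝ := ((univ.filter fun u : Fin n → Bool => g u ≠ 0 ∧ wt u % 3 = r % 3).card : ℝ) with hA
  have hA0 : 0 ≤ A := by positivity
  by_cases hg0 : g = 0
  · subst hg0
    have hB0 : B = 0 := by rw [hB]; simp
    rw [hB0, mul_zero]
    exact hA0
  -- sizes
  have h4d : 1 ≤ 4 ^ d := Nat.one_le_pow _ _ (by norm_num)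
  have hnd : K + d ≤ n := by
    have h1 : K * (d + 1) ≤ K * (d + 1) * 4 ^ d := Nat.le_mul_of_pos_right _ (by positivity)
    have h2 : K + d ≤ K * (d + 1) := by nlinarith
    omega
  have hBge : (2 : ℝ) ^ (n - d) ≤ B := by
    rw [hB]; exact_mod_cast two_pow_le_card_support hg hg0
  have hcls := (abs_le.1 (abs_three_mul_card_class_sub_card_support_le g hg r)).1
  -- (i) `1 ≤ ε·2^{n−d}`
  have h1 : (1 : ℝ) ≤ ε * 2 ^ (n - d) := by
    have hhalf : (1 / 2 : ℝ) ^ (n - d) ≤ ε :=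
      (pow_le_pow_of_le_one (by norm_num) (by norm_num) (by omega : K ≤ n - d)).trans hKε
    have : (1 / 2 : ℝ) ^ (n - d) * 2 ^ (n - d) = 1 := by
      rw [one_div_pow, one_div, inv_mul_cancel₀ (by positivity)]
    nlinarith [pow_pos (show (0:ℝ) < 2 by norm_num) (n - d)]
  -- (ii) `2ⁿ e^{−3n/(8·4^d)} ≤ ε·2^{n−d}`
  set y : ℝ := Real.exp (-(3 / 8)) with hy
  have hy0 : 0 < y := Real.exp_pos _
  have hy1 : y < 1 := Real.exp_lt_one_iff.2 (by norm_num)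
  have hyK : 2 * y ^ K ≤ 1 := by
    have h38 : y ^ K ≤ y ^ 3 := pow_le_pow_of_le_one hy0.le hy1.le hK3
    have h98 : y ^ 3 ≤ 1 / 2 := by
      have he : y ^ 3 = Real.exp (-(9 / 8)) := by
        rw [hy, ← Real.exp_nat_mul]; norm_num
      have h2 : (2 : ℝ) ≤ Real.exp (9 / 8) := by
        have := Real.add_one_le_exp (9 / 8 : ℝ); linarith
      rw [he, Real.exp_neg, one_div]
      exact inv_anti₀ (by norm_num) h2
    linarith
  have h2 : (2 : ℝ) ^ n * Real.exp (-(3 * (n : ℝ) / (8 * 4 ^ d))) ≤ ε * 2 ^ (n - d) := by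
    have hn' : (K : ℝ) * (d + 1) * 4 ^ d ≤ n := by exact_mod_cast hn
    -- the exponent
    have hexp : Real.exp (-(3 * (n : ℝ) / (8 * 4 ^ d))) ≤ (y ^ K) ^ (d + 1) := by
      rw [← pow_mul, hy, ← Real.exp_nat_mul, Real.exp_le_exp]
      have h4 : (0 : ℝ) < 8 * 4 ^ d := by positivity
      have hkey : ((K * (d + 1) : ℕ) : ℝ) * (3 / 8) ≤ 3 * (n : ℝ) / (8 * 4 ^ d) := by
        rw [le_div_iff₀ h4]
        push_cast
        nlinarith [h4]
      linarith
    have hsplit : (2 : ℝ) ^ n = 2 ^ (n - d) * 2 ^ d := by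
      rw [← pow_add, Nat.sub_add_cancel (by omega)]
    have hsmall : (2 : ℝ) ^ d * (y ^ K) ^ (d + 1) ≤ ε := by
      calc (2 : ℝ) ^ d * (y ^ K) ^ (d + 1) ≤ 2 ^ (d + 1) * (y ^ K) ^ (d + 1) := by
            gcongr
            · norm_num
            · omega
        _ = (2 * y ^ K) ^ (d + 1) := by rw [mul_pow]
        _ ≤ (2 * y ^ K) ^ 1 := pow_le_pow_of_le_one (by positivity) hyK (by omega)
        _ = 2 * y ^ K := pow_one _
        _ ≤ ε := hKe
    calc (2 : ℝ) ^ n * Real.exp (-(3 * (n : ℝ) / (8 * 4 ^ d)))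
        ≤ 2 ^ n * (y ^ K) ^ (d + 1) := mul_le_mul_of_nonneg_left hexp (by positivity)
      _ = 2 ^ (n - d) * (2 ^ d * (y ^ K) ^ (d + 1)) := by rw [hsplit]; ring
      _ ≤ 2 ^ (n - d) * ε := mul_le_mul_of_nonneg_left hsmall (by positivity)
      _ = ε * 2 ^ (n - d) := mul_comm _ _
  -- assemble
  have hεB : ε * 2 ^ (n - d) ≤ ε * B := mul_le_mul_of_nonneg_left hBge hε.le
  have herr : 1 + (2 : ℝ) ^ n * Real.exp (-(3 * (n : ℝ) / (8 * 4 ^ d))) ≤ 2 * (ε * B) := by linarith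
  have hB0 : 0 ≤ ε * B := by positivity
  nlinarith

end Summit.QuantumAdvantage.AdviceFreeQNC0
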